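import Mathlib
import Summits.Ventures.PercRepro2.SwOutCrossGenMarkQ

/-!
# The fibre data with an extra vertex and the link label of the mark (blind cell PercRepro2,
night-4 g27, 2026-08-28; proofs/NIGHT4-G27.md §1)

g24's injection `thetaKE` of EVERY non-red-leaking fibre point of a connected cross component
improves g26's LINK label `labelKEQ G q` as well: on the exceptional points (everything dropped,
blue outside) no port is red, and a blue port of the image blue-linked to the mark was already so
at the source, where every u-edge of the flip is red; on the lower core points every port of the
image is attached, so a red port red-linked to the mark stays so, and the image has no blue port;
on the upper core points the source has no red port and the image no blue port; on the generic
branch `thetaKE = psiKE` and g26's `RQ_psiKE` / `BQ_psiKE` apply (**`thetaKE_ok_Q`**).  Hence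
**`fibKEEQBit G hG q`** is a `FibreDataBit` with the link label — the base of the iterated
gluing of several cross components with the mark at a dropped vertex
(`SwOutCrossGenSumJointQ`).
-/

namespace Summit.Ventures.PercRepro2

namespace CrossArm

open Classical

variable {V : Type*} (G : SimpleGraph V)

section ThetaQ

/-- **`thetaKE` improves the link label**: the red ports red-linked to the mark are kept, and a
blue port of the image blue-linked to the mark was already one at the source. -/
theorem thetaKE_ok_Q [Nonempty V] (q : V) (w : FibKE V G) (hr : leakKE G w = false) :
    BetterKEQ (labelKEQ G q (thetaKE G w)) (labelKEQ G q w) := by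
  refine ⟨(thetaKE_ok G w hr).2.1, fun j hj => ?_, fun j hj => ?_⟩
  · -- the red ports red-linked to the mark are kept
    have hj1 : w.2.2 j = false := hj.1
    have hj2 : rlinkE G w q j := hj.2
    by_cases hex : ExcKE G w
    · exfalso
      rw [hex.2 j] at hj1
      exact Bool.noConfusion hj1
    by_cases h0 : C0KE G w
    · -- the lower core point: everything attached in the image, red outside
      have e : thetaKE G w = (fun _ => true, w.2.1, fun _ => false) := by
        simp only [thetaKE, if_neg hex, if_pos h0]
      show (thetaKE G w).2.2 j = false ∧ rlinkE G (thetaKE G w) q j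
      rw [e]
      exact ⟨rfl, rlinkE_of_uP_true G (fun _ => rfl) q j⟩
    by_cases h1 : C1KE G w
    · exfalso
      rw [h1.2 j] at hj1
      exact Bool.noConfusion hj1
    · show (thetaKE G w).2.2 j = false ∧ rlinkE G (thetaKE G w) q j
      simp only [thetaKE, if_neg hex, if_neg h0, if_neg h1]
      exact RQ_psiKE G q hr hj1 hj2
  · -- a blue port of the image blue-linked to the mark was already one at the source
    have hj1 : (thetaKE G w).2.2 j = true := hj.1
    have hj2 : rlinkE G (thetaKE G w).flip q j := hj.2
    by_cases hex : ExcKE G w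
    · -- the exceptional point: at the source every u-edge of the flip is red
      refine ⟨hex.2 j, ?_⟩
      exact rlinkE_of_uP_true G (w := w.flip) (fun i => by simp [FibKE.flip, hex.1 i]) q j
    by_cases h0 : C0KE G w
    · exfalso
      simp only [thetaKE, if_neg hex, if_pos h0] at hj1
      exact Bool.noConfusion hj1
    by_cases h1 : C1KE G w
    · exfalso
      simp only [thetaKE, if_neg hex, if_neg h0, if_pos h1] at hj1
      exact Bool.noConfusion hj1
    · simp only [thetaKE, if_neg hex, if_neg h0, if_neg h1] at hj1 hj2
      exact BQ_psiKE G q hj1 hj2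

end ThetaQ

section Instance

variable [Fintype V] [DecidableEq V] [DecidableRel G.Adj] [Nonempty V] (hG : G.Connected)

/-- **The fibre data with an extra vertex and the link label of the mark `q`**: g26's `fibKEEQ`
with g24's injection `thetaKE`. -/
noncomputable def fibKEEQBit (q : V) : FibreDataBit (FibKE V G) (AtomKEE V G) (LabelKEQ V) :=
  { fibKEEQ G hG q with
    theta := thetaKE G
    theta_ok := fun w hr =>
      ⟨(thetaKE_ok G w hr).1, thetaKE_ok_Q G q w hr, (thetaKE_ok G w hr).2.2⟩
    theta_inj := thetaKE_inj G }

/-- The fibre data with the link label forgets to g26's `fibKEEQ`. -/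
lemma fibKEEQBit_toFibreData (q : V) : (fibKEEQBit G hG q).toFibreData = fibKEEQ G hG q := rfl

/-- **The abstract inequality with one extra dropped vertex and the mark at a dropped vertex of
the component** (any connected cross-edge graph). -/
theorem card_le_crossKEEQBit (q : V) {ι : Type*} [Fintype ι] [DecidableEq ι] [Nonempty ι]
    {𝒯 : Set (TypBG (LabelKEQ V) ι)} (h𝒯 : IsUpBG (fibKEEQBit G hG q) 𝒯)
    {𝓔 : Set (Set (AtomBG (AtomKEE V G) ι))} (h𝓔 : IsUpperSet 𝓔) :
    ((QBG (fibKEEQBit G hG q) 𝒯).filter fun x => ERBG (fibKEEQBit G hG q) x ∈ 𝓔).card ≤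
      ((QBG (fibKEEQBit G hG q) 𝒯).filter fun x => EBBG (fibKEEQBit G hG q) x ∈ 𝓔).card :=
  card_le_crossGenBit (fibKEEQBit G hG q) h𝒯 h𝓔

end Instance

end CrossArm

end Summit.Ventures.PercRepro2
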